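import Literature.MathematicalPhysics.QuantumManyBody.JelliumLemma55
import HarnessLib

/-!
# Identifying the summed pair blocks with the quantities of Lemmas 5.3 and 5.5

Topic `Literature/MathematicalPhysics/QuantumManyBody` (the charged Bose gas, `JelliumBoseGas.foldyLaw`).
Bookkeeping for the assembly of [LiebSolovej2001, §5] in first quantization: summed over ordered pairs
`i ≠ j`, the diagonal blocks `D₁ = ∫w|PᵢQⱼΨ|²`, `D₂ = ∫w|QᵢPⱼΨ|²` of `JelliumPairBlocks` are `ℓ⁻³B`
with the `B = ∑_{i≠j}∫m(xᵢ)|PⱼQᵢΨ|²` of `JelliumLemma53` (`ŵ_{p0,q0}`; dummy integration of the free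
variable), and the one-`Q` blocks satisfy `R₀₂^{(i,j)} = R₀₁^{(j,i)}` (symmetric `w`, `PᵢPⱼ = PⱼPᵢ`,
`QᵢPⱼ = PⱼQᵢ`), so that `∑_{i≠j}(R₀₁+R₀₂) = 2∑ⱼ∑_{i≠j}R₀₁^{(i,j)}`, the quantity bounded by
`JelliumLemma55.ls_lemma55`:

* `lintegral_w_normSq_PQ_eq`, `lintegral_w_normSq_QP_eq` — per pair, `D₁, D₂` through the column/row
  integral of `w`;
* `sum_D1_eq`, `sum_D2_eq` — `∑_{i≠j}D₁ = ∑_{i≠j}D₂ = ℓ⁻³B` (symmetric `w`);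
* `R02_eq_R01_swap`, `sum_R01_add_R02` — the one-`Q` symmetry and `∑_{i≠j}(R₀₁+R₀₂) = 2∑_{i≠j}R₀₁`;
* `re_integral_ofReal_mul` — `Re∫ w·z = ∫ w·Re z` (complex versus real form of the blocks).

## References

* [LiebSolovej2001] E. H. Lieb, J. P. Solovej, Commun. Math. Phys. 217 (2001) 127–163, §5.
-/

noncomputable section

open MeasureTheory Set Filter Real
open scoped ENNReal NNReal Topology ComplexConjugate

namespace Literature.MathematicalPhysics.QuantumManyBody.JelliumBoseGas

open BoseGas

variable {n : ℕ} {ℓ : ℝ}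

/-! ### `D₁`, `D₂` through the column and row integrals -/

section Diagonal

variable {wE : Space → Space → ℝ≥0∞} {Ψ : Config n → ℂ}

/-- **`∫_{Λⁿ} w(xᵢ,xⱼ)|PᵢQⱼΨ|² = ℓ⁻³∫_{Λⁿ}(∫_Λ w(y,xⱼ)dy)|PᵢQⱼΨ|²`** (`i ≠ j`; `PᵢQⱼΨ` is `xᵢ`-free).
[cite: LiebSolovej2001, Lemma 5.3] -/
theorem lintegral_w_normSq_PQ_eq (hℓ : 0 < ℓ) {i j : Fin n} (hij : i ≠ j)
    (hw : Measurable (Function.uncurry wE)) (hΨ : Continuous Ψ) :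
    ∫⁻ X in cellN n ℓ, wE (X i) (X j) * (‖sliceMean ℓ i (sliceFluct ℓ j Ψ) X‖₊ : ℝ≥0∞) ^ 2 =
      (ENNReal.ofReal ℓ ^ 3)⁻¹ * ∫⁻ X in cellN n ℓ, (∫⁻ y in cell ℓ, wE y (X j)) *
        (‖sliceMean ℓ i (sliceFluct ℓ j Ψ) X‖₊ : ℝ≥0∞) ^ 2 := by
  have hg : Measurable (Function.uncurry fun (X : Config n) (y : Space) => wE y (X j)) := by
    have e : (Function.uncurry fun (X : Config n) (y : Space) => wE y (X j)) =
        Function.uncurry wE ∘ fun p : Config n × Space => (p.2, p.1 j) := rfl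
    rw [e]; exact hw.comp (by fun_prop)
  exact lintegral_cellN_weight_of_update_invariant hℓ i (g := fun X y => wE y (X j)) hg
    (fun X y z => by simp only [Function.update_of_ne (Ne.symm hij)])
    (continuous_sliceMean ℓ i (continuous_sliceFluct ℓ j hΨ)).measurable
    (fun X z => sliceMean_update ℓ i _ X z)

/-- **`∫_{Λⁿ} w(xᵢ,xⱼ)|QᵢPⱼΨ|² = ℓ⁻³∫_{Λⁿ}(∫_Λ w(xᵢ,y)dy)|PⱼQᵢΨ|²`** (`i ≠ j`; `QᵢPⱼΨ = PⱼQᵢΨ` is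
`xⱼ`-free). [cite: LiebSolovej2001, Lemma 5.3] -/
theorem lintegral_w_normSq_QP_eq (hℓ : 0 < ℓ) {i j : Fin n} (hij : i ≠ j)
    (hw : Measurable (Function.uncurry wE)) (hΨ : Continuous Ψ) :
    ∫⁻ X in cellN n ℓ, wE (X i) (X j) * (‖sliceFluct ℓ i (sliceMean ℓ j Ψ) X‖₊ : ℝ≥0∞) ^ 2 =
      (ENNReal.ofReal ℓ ^ 3)⁻¹ * ∫⁻ X in cellN n ℓ, (∫⁻ y in cell ℓ, wE (X i) y) *
        (‖sliceMean ℓ j (sliceFluct ℓ i Ψ) X‖₊ : ℝ≥0∞) ^ 2 := by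
  have hcomm : ∀ X, sliceFluct ℓ i (sliceMean ℓ j Ψ) X = sliceMean ℓ j (sliceFluct ℓ i Ψ) X := fun X =>
    (sliceMean_sliceFluct_comm hℓ j i hΨ X).symm
  simp_rw [hcomm]
  have hg : Measurable (Function.uncurry fun (X : Config n) (y : Space) => wE (X i) y) := by
    have e : (Function.uncurry fun (X : Config n) (y : Space) => wE (X i) y) =
        Function.uncurry wE ∘ fun p : Config n × Space => (p.1 i, p.2) := rfl
    rw [e]; exact hw.comp (by fun_prop)
  exact lintegral_cellN_weight_of_update_invariant hℓ j (g := fun X y => wE (X i) y) hg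
    (fun X y z => by simp only [Function.update_of_ne hij])
    (continuous_sliceMean ℓ j (continuous_sliceFluct ℓ i hΨ)).measurable
    (fun X z => sliceMean_update ℓ j _ X z)

/-- **`∑_{i≠j}D₁ = ℓ⁻³B`**: summed over ordered pairs, the blocks `∫w|PᵢQⱼΨ|²` equal `ℓ⁻³` times the
`ŵ_{p0,q0}` quantity `B = ∑ᵢ∑_{j≠i}∫(∫_Λ w(y,xᵢ)dy)|PⱼQᵢΨ|²` of Lemma 5.3. [cite: LiebSolovej2001, Lemma 5.3] -/
theorem sum_D1_eq (hℓ : 0 < ℓ) (hw : Measurable (Function.uncurry wE)) (hΨ : Continuous Ψ) :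
    ∑ i : Fin n, ∑ j ∈ Finset.univ.erase i,
        ∫⁻ X in cellN n ℓ, wE (X i) (X j) * (‖sliceMean ℓ i (sliceFluct ℓ j Ψ) X‖₊ : ℝ≥0∞) ^ 2 =
      (ENNReal.ofReal ℓ ^ 3)⁻¹ * ∑ i : Fin n, ∑ j ∈ Finset.univ.erase i,
        ∫⁻ X in cellN n ℓ, (∫⁻ y in cell ℓ, wE y (X i)) *
          (‖sliceMean ℓ j (sliceFluct ℓ i Ψ) X‖₊ : ℝ≥0∞) ^ 2 := by
  rw [Finset.mul_sum]
  -- rename `(i,j) ↦ (j,i)` on the left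
  rw [Finset.sum_comm' (t' := Finset.univ) (s' := fun j => Finset.univ.erase j)
    (h := fun i j => by
      simp only [Finset.mem_univ, Finset.mem_erase, ne_eq, and_true, true_and]
      exact ⟨fun h => Ne.symm h, fun h => Ne.symm h⟩)]
  refine Finset.sum_congr rfl fun j _ => ?_
  rw [Finset.mul_sum]
  refine Finset.sum_congr rfl fun i hi => ?_
  exact lintegral_w_normSq_PQ_eq hℓ (Finset.ne_of_mem_erase hi) hw hΨ

/-- **`∑_{i≠j}D₂ = ℓ⁻³B`** for a symmetric weight. [cite: LiebSolovej2001, Lemma 5.3] -/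
theorem sum_D2_eq (hℓ : 0 < ℓ) (hw : Measurable (Function.uncurry wE)) (hsymm : ∀ x y, wE x y = wE y x)
    (hΨ : Continuous Ψ) :
    ∑ i : Fin n, ∑ j ∈ Finset.univ.erase i,
        ∫⁻ X in cellN n ℓ, wE (X i) (X j) * (‖sliceFluct ℓ i (sliceMean ℓ j Ψ) X‖₊ : ℝ≥0∞) ^ 2 =
      (ENNReal.ofReal ℓ ^ 3)⁻¹ * ∑ i : Fin n, ∑ j ∈ Finset.univ.erase i,
        ∫⁻ X in cellN n ℓ, (∫⁻ y in cell ℓ, wE y (X i)) *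
          (‖sliceMean ℓ j (sliceFluct ℓ i Ψ) X‖₊ : ℝ≥0∞) ^ 2 := by
  rw [Finset.mul_sum]
  refine Finset.sum_congr rfl fun i _ => ?_
  rw [Finset.mul_sum]
  refine Finset.sum_congr rfl fun j hj => ?_
  rw [lintegral_w_normSq_QP_eq hℓ (Finset.ne_of_mem_erase hj).symm hw hΨ]
  simp_rw [hsymm]

end Diagonal

/-! ### The one-`Q` blocks -/

section OneQ

variable {w : Space → Space → ℝ} {Ψ : Config n → ℂ}

/-- **`R₀₂^{(i,j)} = R₀₁^{(j,i)}`**: for a symmetric weight and continuous `Ψ`,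
`∫w(xᵢ,xⱼ)Re(conj(PᵢPⱼΨ)QᵢPⱼΨ) = ∫w(xⱼ,xᵢ)Re(conj(PⱼPᵢΨ)PⱼQᵢΨ)` (`PᵢPⱼ = PⱼPᵢ`, `QᵢPⱼ = PⱼQᵢ`).
[cite: LiebSolovej2001, Lemma 5.5] -/
theorem R02_eq_R01_swap (hℓ : 0 < ℓ) (hsymm : ∀ x y, w x y = w y x) (i j : Fin n) (hΨ : Continuous Ψ) :
    ∫ X in cellN n ℓ, w (X i) (X j) *
        (conj (sliceMean ℓ i (sliceMean ℓ j Ψ) X) * sliceFluct ℓ i (sliceMean ℓ j Ψ) X).re =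
      ∫ X in cellN n ℓ, w (X j) (X i) *
        (conj (sliceMean ℓ j (sliceMean ℓ i Ψ) X) * sliceMean ℓ j (sliceFluct ℓ i Ψ) X).re := by
  refine integral_congr_ae (Eventually.of_forall fun X => ?_)
  simp only
  rw [hsymm (X i) (X j), sliceMean_comm ℓ i j hΨ X, sliceMean_sliceFluct_comm hℓ j i hΨ X]

/-- **`∑_{i≠j}(R₀₁ + R₀₂) = 2∑ⱼ∑_{i≠j}R₀₁^{(i,j)}`** for a symmetric weight and continuous `Ψ`
(the ordered-pair sum of the one-`Q` blocks is twice the quantity of Lemma 5.5 summed over `j`).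
[cite: LiebSolovej2001, Lemma 5.5] -/
theorem sum_R01_add_R02 (hℓ : 0 < ℓ) (hsymm : ∀ x y, w x y = w y x) (hΨ : Continuous Ψ) :
    ∑ i : Fin n, ∑ j ∈ Finset.univ.erase i,
        ((∫ X in cellN n ℓ, w (X i) (X j) *
            (conj (sliceMean ℓ i (sliceMean ℓ j Ψ) X) * sliceMean ℓ i (sliceFluct ℓ j Ψ) X).re) +
          ∫ X in cellN n ℓ, w (X i) (X j) *
            (conj (sliceMean ℓ i (sliceMean ℓ j Ψ) X) * sliceFluct ℓ i (sliceMean ℓ j Ψ) X).re) =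
      2 * ∑ j : Fin n, ∑ i ∈ Finset.univ.erase j, ∫ X in cellN n ℓ, w (X i) (X j) *
        (conj (sliceMean ℓ i (sliceMean ℓ j Ψ) X) * sliceMean ℓ i (sliceFluct ℓ j Ψ) X).re := by
  rw [Finset.sum_congr rfl fun i _ => Finset.sum_add_distrib, Finset.sum_add_distrib]
  -- the `R₀₂` sum becomes the `R₀₁` sum after `(i,j) ↦ (j,i)`
  have h2 : ∑ i : Fin n, ∑ j ∈ Finset.univ.erase i, ∫ X in cellN n ℓ, w (X i) (X j) *
      (conj (sliceMean ℓ i (sliceMean ℓ j Ψ) X) * sliceFluct ℓ i (sliceMean ℓ j Ψ) X).re =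
      ∑ j : Fin n, ∑ i ∈ Finset.univ.erase j, ∫ X in cellN n ℓ, w (X i) (X j) *
        (conj (sliceMean ℓ i (sliceMean ℓ j Ψ) X) * sliceMean ℓ i (sliceFluct ℓ j Ψ) X).re := by
    rw [Finset.sum_congr rfl fun i _ => Finset.sum_congr rfl fun j _ => R02_eq_R01_swap hℓ hsymm i j hΨ]
  -- the `R₀₁` sum reindexed
  have h1 : ∑ i : Fin n, ∑ j ∈ Finset.univ.erase i, ∫ X in cellN n ℓ, w (X i) (X j) *
      (conj (sliceMean ℓ i (sliceMean ℓ j Ψ) X) * sliceMean ℓ i (sliceFluct ℓ j Ψ) X).re =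
      ∑ j : Fin n, ∑ i ∈ Finset.univ.erase j, ∫ X in cellN n ℓ, w (X i) (X j) *
        (conj (sliceMean ℓ i (sliceMean ℓ j Ψ) X) * sliceMean ℓ i (sliceFluct ℓ j Ψ) X).re :=
    Finset.sum_comm' (h := fun i j => by
      simp only [Finset.mem_univ, Finset.mem_erase, ne_eq, and_true, true_and]
      exact ⟨fun h => Ne.symm h, fun h => Ne.symm h⟩)
  rw [h1, h2]
  ring

/-- `Re∫ (w : ℂ)·z = ∫ w·Re z` for an integrable complex integrand (complex versus real form of the
blocks). [folklore] -/
theorem re_integral_ofReal_mul {μ : Measure (Config n)} {g : Config n → ℝ} {z : Config n → ℂ}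
    (h : Integrable (fun X => (g X : ℂ) * z X) μ) :
    (∫ X, (g X : ℂ) * z X ∂μ).re = ∫ X, g X * (z X).re ∂μ := by
  have hre := Complex.reCLM.integral_comp_comm h
  simp only [Complex.reCLM_apply] at hre
  rw [← hre]
  refine integral_congr_ae (Eventually.of_forall fun X => ?_)
  simp only [Complex.re_ofReal_mul]

end OneQ

end Literature.MathematicalPhysics.QuantumManyBody.JelliumBoseGas
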